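import Summits.CriticalPhenomena.CardyFormulaZ2.Theorems.CardyMagicRigidityMarkovCascadeDefs
import Literature.Probability.Percolation.SiteLoopDensity

/-!
# `d_CN`-closeness from density of small loops and matching of big loops: stub
`isClose_of_dense_of_forall_big` of line `markov-cascade-one-generation` for crux `NestingRigidity`
(stmt-CriticalPhenomena-4835)

A deterministic, purely metric reduction of DKKMO's relation `LoopConfig.IsClose ε c c'`
(`d_CN(c, c') ≤ ε`): it holds as soon as

* (density) at every point `z` of the window `B(0, 1/ε)` both configurations have, for both types
  `i`, a loop of type `i` with trace inside `B(z, ε/4)`, and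
* (big loops) every loop of either configuration with trace in the window and of diameter `≥ ε/8`
  has a same-type partner in the other configuration at `udist ≤ ε`.

Indeed a loop `u` in the window of diameter `< ε/8` contains a point `z` of the window; the density
partner `u'` of the same type has trace in `B(z, ε/4)`, the trace of `u` is in `closedBall z (ε/8)`,
so both traces lie in `closedBall z (ε/4)` and `udist u u' ≤ 2 · (ε/4) ≤ ε`
(`UnbasedLoop.udist_le_of_subset_closedBall`).
-/

noncomputable section

open MeasureTheory Set Filter
open scoped Topology BigOperators ENNReal Real

namespace Summit.CriticalPhenomena.CardyFormulaZ2.Cruxes.NestingRigidity.MarkovCascadeOneGeneration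

open Literature.Probability.RandomPlanarGeometry Literature.Probability.Percolation
  Literature.Probability.LatticeModels
open Summit.CriticalPhenomena.CardyFormulaZ2.Theses.CardyMagicRigidity

/-- One half of the `d_CN` reduction, for one type: if every point of the window `B(0, 1/ε)` has a
loop of the family `B` with trace in `B(z, ε/4)`, and every loop of the family `A` in the window of
diameter `≥ ε/8` has a partner in `B` at `udist ≤ ε`, then every loop of `A` in the window has a
partner in `B` at `udist ≤ ε`. [folklore] -/
theorem forall_exists_udist_le_of_dense_of_forall_big {ε : ℝ} (hε : 0 < ε)
    {A B : Set (UnbasedLoop ℂ)}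
    (hdense : ∀ z ∈ Metric.ball (0 : ℂ) (1 / ε), ∃ u' ∈ B, u'.range ⊆ Metric.ball z (ε / 4))
    (hbig : ∀ u ∈ A, u.range ⊆ Metric.ball (0 : ℂ) (1 / ε) → ε / 8 ≤ Metric.diam u.range →
      ∃ u' ∈ B, u.udist u' ≤ ε) :
    ∀ u ∈ A, u.range ⊆ Metric.ball (0 : ℂ) (1 / ε) → ∃ u' ∈ B, u.udist u' ≤ ε := by
  intro u hu hw
  by_cases hd : ε / 8 ≤ Metric.diam u.range
  · exact hbig u hu hw hd
  · rw [not_le] at hd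
    obtain ⟨z, hz⟩ := u.range_nonempty
    obtain ⟨u', hu', hu'r⟩ := hdense z (hw hz)
    refine ⟨u', hu', ?_⟩
    have h1 : u.range ⊆ Metric.closedBall z (ε / 4) := fun x hx ↦ by
      rw [Metric.mem_closedBall]
      calc dist x z ≤ Metric.diam u.range :=
            Metric.dist_le_diam_of_mem u.isCompact_range.isBounded hx hz
        _ ≤ ε / 4 := by linarith
    have h2 : u'.range ⊆ Metric.closedBall z (ε / 4) := hu'r.trans Metric.ball_subset_closedBall
    calc u.udist u' ≤ 2 * (ε / 4) :=
          UnbasedLoop.udist_le_of_subset_closedBall (by positivity) h1 h2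
      _ ≤ ε := by linarith

/-- **`d_CN(c, c') ≤ ε` from `ε/4`-density of both types of both configurations in the window and
matching of the loops of diameter `≥ ε/8`** (deterministic reduction used to separate the soup of
small loops from the macroscopic ones in the law statements of the Markov cascade). [folklore] -/
theorem isClose_of_dense_of_forall_big : ∀ {ε : ℝ} {c c' : LoopConfig ℂ}, 0 < ε → (∀ z ∈ Metric.ball (0 : ℂ) (1 / ε), ∀ i : Fin 2, (∃ u ∈ c.F i, u.range ⊆ Metric.ball z (ε / 4)) ∧ (∃ u' ∈ c'.F i, u'.range ⊆ Metric.ball z (ε / 4))) → (∀ i : Fin 2, ∀ u ∈ c.F i, u.range ⊆ Metric.ball (0 : ℂ) (1 / ε) → ε / 8 ≤ Metric.diam u.range → ∃ u' ∈ c'.F i, u.udist u' ≤ ε) → (∀ i : Fin 2, ∀ u' ∈ c'.F i, u'.range ⊆ Metric.ball (0 : ℂ) (1 / ε) → ε / 8 ≤ Metric.diam u'.range → ∃ u ∈ c.F i, u'.udist u ≤ ε) → LoopConfig.IsClose ε c c' := by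
  intro ε c c' hε hdense hbig hbig' i
  exact ⟨forall_exists_udist_le_of_dense_of_forall_big hε (fun z hz ↦ (hdense z hz i).2) (hbig i),
    forall_exists_udist_le_of_dense_of_forall_big hε (fun z hz ↦ (hdense z hz i).1) (hbig' i)⟩

end Summit.CriticalPhenomena.CardyFormulaZ2.Cruxes.NestingRigidity.MarkovCascadeOneGeneration

end
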